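import Summits.RiemannHypothesis.RiemannHypothesis.Theses.NymanBeurling
import Summits.RiemannHypothesis.RiemannHypothesis.Theorems.NymanBeurlingNbThesis
import Summits.RiemannHypothesis.RiemannHypothesis.Theorems.NymanBeurlingNbThesisLowerBound
import Literature.Barriers.RiemannHypothesis.NymanBeurlingObstructionsBurnolProofs

/-!
# RiemannHypothesis / NymanBeurling — crux #2 `NbRateLog`: every admissible constant is at least Burnol's `2π Σ_ρ m_ρ²/|ρ|²`

Route `RiemannHypothesis/NymanBeurling`, crux #2 `NbRateLog` (item stmt-RiemannHypothesis-0394):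

  `∃ C, ∀ N ≥ 2, ∃ a : Fin N → ℂ, ∫⁻ ‖1 - ζ(1/2+it) Σ_{k<N} a_k (k+1)^{-(1/2+it)}‖² dt/(1/4+t²) ≤ C / log N`.

Call `C` ADMISSIBLE when the displayed clause holds for it. The item's informal text says "the
constant encodes `Σ m(ρ)²/|ρ|²`, i.e. simplicity". This file proves that sentence, unconditionally
and in the item's exact integrand, from theorems already PROVED in the tree — Burnol 2002 Thm. 1.3
(`Literature.Barriers.RiemannHypothesis.Burnol2002_thm1_3_holds`, with its finite-family core
`Burnol2002Assembly.eventually_nbDist_ge_of_finset`) and BDBLS 2000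
(`Literature.Barriers.RiemannHypothesis.BDBLS2000_thm_holds`):

* `two_pi_mul_nbDist_sq_le` — the bridge: Burnol's distance `D(λ)` (`nbDist`, real dilations
  `θ ∈ [λ,1]`, real coefficients, `L²(0,∞)`) at `λ = 1/N` satisfies
  `2π · D(1/N)² ≤ ∫⁻ ‖1 - ζA‖²/(1/4+t²)` for EVERY `a : Fin N → ℂ` (Mellin–Plancherel, as in
  `nbIntegrand_lowerBound`, keeping the sharp factor `2π` instead of an absolute constant);
* `two_pi_mul_le_of_nbRateBound` — transfer: any eventual bound
  `(√S - ε)/√log(1/λ) ≤ D(λ)` (`λ → 0⁺`, all `ε > 0`) forces `2π S ≤ C` for every admissible `C`;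
* `two_pi_mul_sum_multSq_le_of_nbRateBound` — for every finite set `T` of zeros of `ζ` on the
  critical line, `2π Σ_{ρ ∈ T} m_ρ²/|ρ|² ≤ C` (`m_ρ = riemannZetaZeroOrder ρ`, the multiplicity);
* `two_pi_mul_zeroSumMultSq_le_of_nbRateBound`, `two_pi_mul_zeroSumInvNormSq_le_of_nbRateBound` —
  the `tsum` forms `2π Σ_ρ m_ρ²/|ρ|² ≤ C`, `2π Σ_ρ 1/|ρ|² ≤ C` (Burnol's and BDBLS's constants);
* `two_pi_mul_multSq_le_of_nbRateBound` — in particular `2π m_ρ² ≤ C |ρ|²` for every zero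
  `ρ` on the line: an admissible constant BOUNDS EVERY MULTIPLICITY, `m_ρ ≤ |ρ| √(C/2π)`;
* `summable_multSq_of_nbRateLog`, `nbRateLog_multiplicity_bound` — under `NbRateLog` itself
  (which implies RH, `riemannHypothesis_of_nbRateLog`) the family `m_ρ²/|ρ|²` over ALL nontrivial
  zeros is summable with `2π Σ ≤ C`, and every nontrivial zero has `2π m_ρ² ≤ C |ρ|²`.

So a proof of crux #2 with constant `C` is automatically a proof of RH plus the quantitative
simplicity statement `Σ_ρ m_ρ²/|ρ|² ≤ C/2π`; the conjectured optimal constant is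
`C = 2π(2 + γ - log 4π) = 2π Σ_ρ 1/|ρ|²` under RH with simple zeros [BDBLS2000;
BettinConreyFarmer2013, §1].

References: J.-F. Burnol, Adv. Math. 170 (2002) 56–70, Thm. 1.3; L. Báez-Duarte, M. Balazard,
B. Landreau, E. Saias, Adv. Math. 149 (2000) 130–144; S. Bettin, J. B. Conrey, D. W. Farmer,
Proc. Steklov Inst. 280 (2013), §1.
-/

noncomputable section

open Complex MeasureTheory Set Filter Topology
open scoped Real ENNReal

namespace Summit.RiemannHypothesis.RiemannHypothesis.Theorems

open Summit.RiemannHypothesis.RiemannHypothesis.Theses.NymanBeurling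
open Literature.NumberTheory.LFunctions Literature.NumberTheory.LFunctions.BaezDuarteU
open Literature.Barriers.RiemannHypothesis

/-- **Bridge to Burnol's distance.** For every `N` and every `a : Fin N → ℂ`,
`2π · D(1/N)² ≤ ∫⁻ ‖1 - ζ(1/2+it) Σ_{k<N} a_k (k+1)^{-(1/2+it)}‖² dt/(1/4+t²)`, where
`D(λ) = nbDist λ` is the `L²(0,∞)` distance from `χ` to the real span of the `ρ(θ/·)`, `λ ≤ θ ≤ 1`.
Mellin–Plancherel makes the integral `2π ‖χ + Σ a_k ρ_{k+1}‖²`, which dominates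
`2π ‖χ - Σ (-Re a_k) ρ_{k+1}‖² ≥ 2π D(1/N)²` (integer dilations `k+1 ≤ N` are admissible).
[cite: Burnol2002, §3] [cite: BaezDuarte2003, §2.2 (2.4)] -/
theorem two_pi_mul_nbDist_sq_le (N : ℕ) (a : Fin N → ℂ) :
    ENNReal.ofReal (2 * π) * nbDist ((N : ℝ)⁻¹) ^ 2 ≤
      ∫⁻ t : ℝ, ENNReal.ofReal (‖1 - riemannZeta (1 / 2 + t * Complex.I) *
        ∑ n : Fin N, a n * ((n : ℂ) + 1) ^ (-(1 / 2 + t * Complex.I))‖ ^ 2 / (1 / 4 + t ^ 2)) := by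
  set d : Fin N → ℝ := fun k ↦ ((k : ℕ) : ℝ) + 1 with hd
  have hd1 : ∀ j, 1 ≤ d j := fun j ↦ (natDilation_le_max N j).1
  have hdN : ∀ j, 1 ≤ d j ∧ d j ≤ 1 / ((N : ℝ)⁻¹) := fun j ↦
    ⟨hd1 j, by
      rw [one_div, inv_inv]
      show ((j : ℕ) : ℝ) + 1 ≤ (N : ℝ)
      exact_mod_cast Nat.succ_le_of_lt j.isLt⟩
  set x : Fin N → ℝ := fun j ↦ -(a j).re with hx
  set y : Fin N → ℝ := fun j ↦ (a j).im with hy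
  set g : ℝ → ℂ := fun t ↦ nbFun d x t + I * (nbFun d (fun _ ↦ (0 : ℝ)) t - nbFun d y t) with hg
  -- `g ∈ L²`, `M[g]` converges on the critical line
  have hgL2 : MemLp g 2 (volume.restrict (Ioi (0 : ℝ))) :=
    (memLp_two_nbFun d x hd1).add
      (((memLp_two_nbFun d _ hd1).sub (memLp_two_nbFun d y hd1)).const_mul I)
  have hg2 : IntegrableOn (fun t ↦ ‖g t‖ ^ 2) (Ioi 0) :=
    (memLp_two_iff_integrable_sq_norm hgL2.1).1 hgL2
  have hgM : MellinConvergent g (1 / 2) :=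
    (hasMellin_nbComplexApprox a (s := 1 / 2) (by norm_num) (by norm_num)).1
  obtain ⟨hint, hP⟩ := Literature.Analysis.FunctionSpaces.integral_norm_sq_mellin_half_eq hgM hg2
  -- the integrand is `‖M[g](1/2+it)‖²`
  have hpt : ∀ t : ℝ, ‖1 - riemannZeta (1 / 2 + t * Complex.I) *
      ∑ n : Fin N, a n * ((n : ℂ) + 1) ^ (-(1 / 2 + t * Complex.I))‖ ^ 2 / (1 / 4 + t ^ 2) =
      ‖mellin g (1 / 2 + t * I)‖ ^ 2 := by
    intro t
    rw [(hasMellin_nbComplexApprox a (s := 1 / 2 + t * I) (by simp) (by simp; norm_num)).2,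
      norm_div, div_pow, norm_sq_one_half_add]
  -- `‖Re g‖² ≤ ‖g‖²` pointwise, hence in `L²`
  have hI0 : 0 ≤ ∫ t in Ioi (0 : ℝ), ‖nbFun d x t‖ ^ 2 := integral_nonneg fun _ ↦ by positivity
  have hmono : ∫ t in Ioi (0 : ℝ), ‖nbFun d x t‖ ^ 2 ≤ ∫ t in Ioi (0 : ℝ), ‖g t‖ ^ 2 := by
    refine integral_mono (integrableOn_norm_sq_nbFun d x hd1) hg2 fun t ↦ ?_
    exact norm_sq_ofReal_le _ _ _
  -- `D(1/N) ≤ ‖χ - Σ x_k ρ_{k+1}‖ = √(∫ |nbFun d x|²)`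
  have hD : nbDist ((N : ℝ)⁻¹) ≤
      ENNReal.ofReal (Real.sqrt (∫ t in Ioi (0 : ℝ), ‖nbFun d x t‖ ^ 2)) := by
    rw [← BDBLS2000.genError_eq d x hd1]
    unfold nbDist
    exact iInf_le_of_le N <| iInf_le_of_le d <| iInf_le_of_le hdN <| iInf_le _ x
  have hD2 : nbDist ((N : ℝ)⁻¹) ^ 2 ≤ ENNReal.ofReal (∫ t in Ioi (0 : ℝ), ‖g t‖ ^ 2) :=
    calc nbDist ((N : ℝ)⁻¹) ^ 2
        ≤ ENNReal.ofReal (Real.sqrt (∫ t in Ioi (0 : ℝ), ‖nbFun d x t‖ ^ 2)) ^ 2 :=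
          pow_le_pow_left' hD 2
      _ = ENNReal.ofReal (∫ t in Ioi (0 : ℝ), ‖nbFun d x t‖ ^ 2) := by
          rw [← ENNReal.ofReal_pow (Real.sqrt_nonneg _), Real.sq_sqrt hI0]
      _ ≤ ENNReal.ofReal (∫ t in Ioi (0 : ℝ), ‖g t‖ ^ 2) := ENNReal.ofReal_le_ofReal hmono
  -- assemble
  calc ENNReal.ofReal (2 * π) * nbDist ((N : ℝ)⁻¹) ^ 2
      ≤ ENNReal.ofReal (2 * π) * ENNReal.ofReal (∫ t in Ioi (0 : ℝ), ‖g t‖ ^ 2) := by gcongr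
    _ = ENNReal.ofReal (2 * π * ∫ t in Ioi (0 : ℝ), ‖g t‖ ^ 2) := by
        rw [← ENNReal.ofReal_mul (by positivity)]
    _ = ENNReal.ofReal (∫ τ : ℝ, ‖mellin g (1 / 2 + τ * I)‖ ^ 2) := by rw [hP]
    _ = ∫⁻ τ : ℝ, ENNReal.ofReal (‖mellin g (1 / 2 + τ * I)‖ ^ 2) :=
        ofReal_integral_eq_lintegral_ofReal hint (Eventually.of_forall fun _ ↦ by positivity)
    _ = _ := lintegral_congr fun t ↦ by rw [hpt t]

/-- **Transfer of Burnol-type lower bounds to the constant of crux #2.** If for every `ε > 0`,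
eventually as `λ → 0⁺`, `(√S - ε)/√log(1/λ) ≤ D(λ)` (the shape of
`Literature.Barriers.RiemannHypothesis.Burnol2002_thm1_3` / `BDBLS2000_thm`), then every constant
`C` admissible in `NbRateLog` satisfies `2π S ≤ C`: along `λ = 1/N`,
`2π(√S - ε)²/log N ≤ 2π D(1/N)² ≤ ∫⁻ ‖1 - ζA_N‖²/(1/4+t²) ≤ C/log N`, then `ε → 0`.
[cite: Burnol2002, Thm. 1.3] -/
theorem two_pi_mul_le_of_nbRateBound {S C : ℝ}
    (hS : ∀ ε : ℝ, 0 < ε → ∀ᶠ lam : ℝ in 𝓝[>] 0,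
      ENNReal.ofReal ((Real.sqrt S - ε) / Real.sqrt (Real.log (1 / lam))) ≤ nbDist lam)
    (hC : ∀ N : ℕ, 2 ≤ N → ∃ a : Fin N → ℂ, ∫⁻ t : ℝ, ENNReal.ofReal (‖1 - riemannZeta (1 / 2 + t * Complex.I) *
        ∑ n : Fin N, a n * ((n : ℂ) + 1) ^ (-(1 / 2 + t * Complex.I))‖ ^ 2 / (1 / 4 + t ^ 2)) ≤
      ENNReal.ofReal (C / Real.log N)) :
    2 * π * S ≤ C := by
  have hCpos : 0 < C := by
    obtain ⟨C₀, hC₀, h⟩ := le_const_of_nbRateBound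
    exact hC₀.trans_le (h C hC)
  by_cases hS0 : S ≤ 0
  · nlinarith [Real.pi_pos]
  push Not at hS0
  -- main step: `2π (√S - ε)² ≤ C` for every `0 < ε < √S`
  have key : ∀ ε : ℝ, 0 < ε → ε < Real.sqrt S → 2 * π * (Real.sqrt S - ε) ^ 2 ≤ C := by
    intro ε hε hεS
    have ht : 0 < Real.sqrt S - ε := by linarith
    have hlam : Tendsto (fun N : ℕ ↦ (N : ℝ)⁻¹) atTop (𝓝[>] 0) :=
      tendsto_inv_atTop_nhdsGT_zero.comp tendsto_natCast_atTop_atTop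
    obtain ⟨N, hN2, hN⟩ := ((eventually_ge_atTop 2).and (hlam.eventually (hS ε hε))).exists
    rw [one_div, inv_inv] at hN
    obtain ⟨a, ha⟩ := hC N hN2
    have hlog : 0 < Real.log (N : ℝ) :=
      Real.log_pos (by exact_mod_cast Nat.lt_of_lt_of_le one_lt_two hN2)
    have e : ENNReal.ofReal (2 * π) *
        ENNReal.ofReal ((Real.sqrt S - ε) / Real.sqrt (Real.log N)) ^ 2 =
          ENNReal.ofReal (2 * π * ((Real.sqrt S - ε) ^ 2 / Real.log N)) := by
      rw [← ENNReal.ofReal_pow (div_nonneg ht.le (Real.sqrt_nonneg _)), div_pow,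
        Real.sq_sqrt hlog.le, ← ENNReal.ofReal_mul (by positivity)]
    have h1 : ENNReal.ofReal (2 * π * ((Real.sqrt S - ε) ^ 2 / Real.log N)) ≤
        ENNReal.ofReal (C / Real.log N) :=
      calc ENNReal.ofReal (2 * π * ((Real.sqrt S - ε) ^ 2 / Real.log N))
          = ENNReal.ofReal (2 * π) *
              ENNReal.ofReal ((Real.sqrt S - ε) / Real.sqrt (Real.log N)) ^ 2 := e.symm
        _ ≤ ENNReal.ofReal (2 * π) * nbDist ((N : ℝ)⁻¹) ^ 2 := by gcongr
        _ ≤ _ := two_pi_mul_nbDist_sq_le N a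
        _ ≤ ENNReal.ofReal (C / Real.log N) := ha
    rw [ENNReal.ofReal_le_ofReal_iff (div_nonneg hCpos.le hlog.le), mul_div_assoc',
      div_le_div_iff_of_pos_right hlog] at h1
    exact h1
  -- let `ε → 0⁺`
  have hlim : Tendsto (fun ε : ℝ ↦ 2 * π * (Real.sqrt S - ε) ^ 2) (𝓝[>] 0)
      (𝓝 (2 * π * (Real.sqrt S - 0) ^ 2)) :=
    ((continuous_const.mul ((continuous_const.sub continuous_id).pow 2)).tendsto 0).mono_left
      nhdsWithin_le_nhds
  rw [sub_zero, Real.sq_sqrt hS0.le] at hlim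
  refine le_of_tendsto hlim ?_
  filter_upwards [Ioo_mem_nhdsGT (Real.sqrt_pos.2 hS0)] with ε hε
  exact key ε hε.1 hε.2

/-- **Finite-family form (the core, junk-free statement).** If `C` is admissible in `NbRateLog`,
then for every finite set `T` of zeros of `ζ` on the critical line,
`2π Σ_{ρ ∈ T} m_ρ²/|ρ|² ≤ C`, `m_ρ = riemannZetaZeroOrder ρ` the multiplicity. (Burnol's Theorem
5.4/1.3 for the finite set `T`, proved in the tree as
`Burnol2002Assembly.eventually_nbDist_ge_of_finset`, transferred by
`two_pi_mul_le_of_nbRateBound`.) [cite: Burnol2002, Thm. 1.3 and Thm. 5.4] -/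
theorem two_pi_mul_sum_multSq_le_of_nbRateBound {C : ℝ}
    (hC : ∀ N : ℕ, 2 ≤ N → ∃ a : Fin N → ℂ, ∫⁻ t : ℝ, ENNReal.ofReal (‖1 - riemannZeta (1 / 2 + t * Complex.I) *
        ∑ n : Fin N, a n * ((n : ℂ) + 1) ^ (-(1 / 2 + t * Complex.I))‖ ^ 2 / (1 / 4 + t ^ 2)) ≤
      ENNReal.ofReal (C / Real.log N))
    (T : Finset ℂ) (hT : ∀ ρ ∈ T, riemannZeta ρ = 0 ∧ ρ.re = 1 / 2) :
    2 * π * ∑ ρ ∈ T, (riemannZetaZeroOrder ρ : ℝ) ^ 2 / ‖ρ‖ ^ 2 ≤ C :=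
  two_pi_mul_le_of_nbRateBound
    (fun _ hε ↦ Burnol2002Assembly.eventually_nbDist_ge_of_finset T hT hε) hC

/-- **Burnol's constant bounds crux #2 from below**: every admissible `C` satisfies
`2π · Σ_ρ m_ρ²/|ρ|² ≤ C`, the `tsum` over the distinct nontrivial zeros
(`Literature.Barriers.RiemannHypothesis.zeroSumMultSqInvNormSq`; Burnol 2002 Thm. 1.3, PROVED in the tree).
[cite: Burnol2002, Thm. 1.3] -/
theorem two_pi_mul_zeroSumMultSq_le_of_nbRateBound {C : ℝ}
    (hC : ∀ N : ℕ, 2 ≤ N → ∃ a : Fin N → ℂ, ∫⁻ t : ℝ, ENNReal.ofReal (‖1 - riemannZeta (1 / 2 + t * Complex.I) *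
        ∑ n : Fin N, a n * ((n : ℂ) + 1) ^ (-(1 / 2 + t * Complex.I))‖ ^ 2 / (1 / 4 + t ^ 2)) ≤
      ENNReal.ofReal (C / Real.log N)) :
    2 * π * zeroSumMultSqInvNormSq ≤ C :=
  two_pi_mul_le_of_nbRateBound Burnol2002_thm1_3_holds hC

/-- **The BDBLS constant bounds crux #2 from below**: every admissible `C` satisfies
`2π · Σ_ρ 1/|ρ|² ≤ C`, the `tsum` over the distinct nontrivial zeros
(`Literature.Barriers.RiemannHypothesis.zeroSumInvNormSq`; BDBLS 2000, PROVED in the tree). Under RH with simple zeros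
this sum is `2 + γ - log 4π`, the conjectured optimal constant of [BDBLS2000].
[cite: Burnol2002, Thm. 1.2] [cite: BDBLS2000, main theorem] -/
theorem two_pi_mul_zeroSumInvNormSq_le_of_nbRateBound {C : ℝ}
    (hC : ∀ N : ℕ, 2 ≤ N → ∃ a : Fin N → ℂ, ∫⁻ t : ℝ, ENNReal.ofReal (‖1 - riemannZeta (1 / 2 + t * Complex.I) *
        ∑ n : Fin N, a n * ((n : ℂ) + 1) ^ (-(1 / 2 + t * Complex.I))‖ ^ 2 / (1 / 4 + t ^ 2)) ≤
      ENNReal.ofReal (C / Real.log N)) :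
    2 * π * zeroSumInvNormSq ≤ C :=
  two_pi_mul_le_of_nbRateBound BDBLS2000_thm_holds hC

/-- **An admissible constant bounds every multiplicity.** If `C` is admissible in `NbRateLog` and
`ρ` is a zero of `ζ` on the critical line of multiplicity `m_ρ`, then `2π m_ρ² ≤ C |ρ|²`, i.e.
`m_ρ ≤ |ρ| √(C / 2π)`. [cite: Burnol2002, Thm. 1.3] -/
theorem two_pi_mul_multSq_le_of_nbRateBound {C : ℝ}
    (hC : ∀ N : ℕ, 2 ≤ N → ∃ a : Fin N → ℂ, ∫⁻ t : ℝ, ENNReal.ofReal (‖1 - riemannZeta (1 / 2 + t * Complex.I) *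
        ∑ n : Fin N, a n * ((n : ℂ) + 1) ^ (-(1 / 2 + t * Complex.I))‖ ^ 2 / (1 / 4 + t ^ 2)) ≤
      ENNReal.ofReal (C / Real.log N))
    {ρ : ℂ} (hζ : riemannZeta ρ = 0) (hρ : ρ.re = 1 / 2) :
    2 * π * (riemannZetaZeroOrder ρ : ℝ) ^ 2 ≤ C * ‖ρ‖ ^ 2 := by
  have h := two_pi_mul_sum_multSq_le_of_nbRateBound hC {ρ}
    (fun ρ' hρ' ↦ by rw [Finset.mem_singleton.1 hρ']; exact ⟨hζ, hρ⟩)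
  rw [Finset.sum_singleton] at h
  have hρ0 : 0 < ‖ρ‖ := norm_pos_iff.2 fun h0 ↦ by norm_num [h0] at hρ
  rw [mul_div_assoc', div_le_iff₀ (pow_pos hρ0 2)] at h
  exact h

/-- Under RH (Mathlib's `RiemannHypothesis`) every nontrivial zero is a zero on the critical line.
[folklore] -/
theorem nontrivialZero_on_line (hRH : _root_.RiemannHypothesis) {ρ : ℂ}
    (hρ : ρ ∈ ZetaZeros.riemannZetaNontrivialZeros) : riemannZeta ρ = 0 ∧ ρ.re = 1 / 2 := by
  obtain ⟨hz, h0, h1⟩ := mem_riemannZetaNontrivialZeros_iff_holds.1 hρ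
  refine ⟨hz, hRH ρ hz ?_ ?_⟩
  · rintro ⟨n, hn⟩
    have e : (-2 * ((n : ℂ) + 1)) = (((-2 : ℝ) * ((n : ℝ) + 1) : ℝ) : ℂ) := by push_cast; ring
    rw [hn, e, Complex.ofReal_re] at h0
    have hn0 : (0 : ℝ) ≤ n := Nat.cast_nonneg n
    linarith
  · rintro rfl
    norm_num at h1

/-- **Crux #2 makes `Σ_ρ m_ρ²/|ρ|²` a genuinely convergent sum.** Under `NbRateLog` (which implies RH,
`riemannHypothesis_of_nbRateLog`, so that every nontrivial zero is on the line) the family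
`ρ ↦ m_ρ²/|ρ|²` over all distinct nontrivial zeros is summable: its finite partial sums are bounded
by `C/2π` (`two_pi_mul_sum_multSq_le_of_nbRateBound`). [cite: Burnol2002, Thm. 1.3] -/
theorem summable_multSq_of_nbRateLog (h : NbRateLog) :
    Summable fun ρ : ZetaZeros.riemannZetaNontrivialZeros ↦
      (riemannZetaZeroOrder (ρ : ℂ) : ℝ) ^ 2 / ‖(ρ : ℂ)‖ ^ 2 := by
  classical
  have hRH : _root_.RiemannHypothesis :=
    Summit.RiemannHypothesis_iff.mp (riemannHypothesis_of_nbRateLog h)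
  unfold NbRateLog at h
  obtain ⟨C, hC⟩ := h
  refine summable_of_sum_le (c := C / (2 * π)) (fun ρ ↦ by positivity) fun T ↦ ?_
  have hT' : ∀ ρ ∈ T.image Subtype.val, riemannZeta ρ = 0 ∧ ρ.re = 1 / 2 := by
    intro ρ hρ
    obtain ⟨x, -, rfl⟩ := Finset.mem_image.1 hρ
    exact nontrivialZero_on_line hRH x.2
  have key := two_pi_mul_sum_multSq_le_of_nbRateBound hC _ hT'
  rw [Finset.sum_image fun x _ y _ hxy ↦ Subtype.ext hxy] at key
  rw [le_div_iff₀ (by positivity)]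
  linarith

/-- **Crux #2, unpacked: RH + a uniform multiplicity bound + Burnol's sum.** If `NbRateLog` holds
then there is `C > 0` with: every nontrivial zero `ρ` of `ζ` lies on the critical line and has
multiplicity `m_ρ` with `2π m_ρ² ≤ C |ρ|²`, and `2π Σ_ρ m_ρ²/|ρ|² ≤ C` as a convergent sum over
all distinct nontrivial zeros. This is the precise sense in which "the constant encodes
`Σ m(ρ)²/|ρ|²`, i.e. simplicity" (item text). [cite: Burnol2002, Thm. 1.3] [cite: BettinConreyFarmer2013, §1] -/
theorem nbRateLog_multiplicity_bound (h : NbRateLog) : ∃ C : ℝ, 0 < C ∧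
    (∀ ρ ∈ ZetaZeros.riemannZetaNontrivialZeros,
      ρ.re = 1 / 2 ∧ 2 * π * (riemannZetaZeroOrder ρ : ℝ) ^ 2 ≤ C * ‖ρ‖ ^ 2) ∧
    HasSum (fun ρ : ZetaZeros.riemannZetaNontrivialZeros ↦
      (riemannZetaZeroOrder (ρ : ℂ) : ℝ) ^ 2 / ‖(ρ : ℂ)‖ ^ 2) zeroSumMultSqInvNormSq ∧
    2 * π * zeroSumMultSqInvNormSq ≤ C := by
  have hRH : _root_.RiemannHypothesis :=
    Summit.RiemannHypothesis_iff.mp (riemannHypothesis_of_nbRateLog h)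
  have hsum := summable_multSq_of_nbRateLog h
  unfold NbRateLog at h
  obtain ⟨C, hC⟩ := h
  have hCpos : 0 < C := by
    obtain ⟨C₀, hC₀, h⟩ := le_const_of_nbRateBound
    exact hC₀.trans_le (h C hC)
  refine ⟨C, hCpos, fun ρ hρ ↦ ?_, hsum.hasSum, two_pi_mul_zeroSumMultSq_le_of_nbRateBound hC⟩
  obtain ⟨hz, hre⟩ := nontrivialZero_on_line hRH hρ
  exact ⟨hre, two_pi_mul_multSq_le_of_nbRateBound hC hz hre⟩

end Summit.RiemannHypothesis.RiemannHypothesis.Theorems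

end
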